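import Summits.NavierStokesRegularity.FunctionalMining.TopEigGapCutoffPowEstimate
import Summits.NavierStokesRegularity.FunctionalMining.TopEigGapCoerciveTwo
import HarnessLib

/-!
# FunctionalMining — PROPOSITION L-λ(η) FOR EVERY `2 ≤ q ≤ 6` ON THE WHOLE TOP-GAP CLASS:
# the node `TopEigGapCoercivePos q η` HOLDS (`0 < η`)

Search for candidate a priori estimates; no regularity claim. Cell `pub-nsfunc`, prove seat
(gen 26). The dictionary's `@[conjecture]` node `TopEigGapCoercivePos q η := ∃ c > 0,
TopEigHeatCoerciveOnGap q η c` (`TopEigHeatCoerciveGap.lean`) types the no-go seat's Proposition L-λ(η)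
(SIEVELD §3.4b (4), pen: "claimed for `2 ≤ q ≤ 6`, `0 < η ≤ 1`; general `q`: `M_q = λ₁^{q−2}M`, Hölder
`2/q + (q−2)/q = 1` and `‖u‖_q ≲ ‖∇u‖₂` for `q ≤ 6`"). `TopEigGapCoerciveTwo` settled `q = 2`; this file
settles `2 < q ≤ 6` from the cut-off estimate `cut_topEigMoment_rpow_estimate`
(`TopEigGapCutoffPowEstimate`, every `δ > 0`):
`Φ_q − 2δ∫λ₁^{q−1} ≤ √(3(q−1)/(2η)) √(KΦ_q) √((2/q)T_q + 4δ∫λ₁^{q−2}‖S(Δv)‖)`, `K = 72(C₆+1)^{1/3}` the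
Sobolev–Hölder constant of `exists_integral_norm_sq_mul_topEig_rpow_le`. Letting `δ → 0`
(`le_of_tendsto_of_tendsto`; `T_q ≥ 0` by the heat sieve):
`Φ_q ≤ √(3(q−1)K'Φ_q/(2η)) √((2/q)T_q)` with `K' = K + 1 > 0`, i.e.
**`(ηq/(3(q−1)K')) · Φ_q(v) ≤ T_q(v)`** for every smooth, divergence-free, zero-mean `v` on `T³` with
`λ₂ ≤ (1−η)λ₁` pointwise.

CONTENT (namespace `Summit.NavierStokesRegularity.FunctionalMining.TopEig`):
* `topEigMoment_rpow_le_heatDissipation_of_gap` — the inequality above, `2 < q ≤ 6`, `0 < η ≤ 1`;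
* **`topEigGapCoercivePos_of_two_lt (2 < q) (q ≤ 6) (0 < η) : TopEigGapCoercivePos (d := Fin 3) q η`**;
* **`topEigGapCoercivePos_of_two_le (2 ≤ q) (q ≤ 6) (0 < η) : TopEigGapCoercivePos (d := Fin 3) q η`** —
  the node on the whole range claimed on paper;
* `violators_outside_every_gap_of_not_pos` — SIEVELD's COROLLARY, unconditional for `2 ≤ q ≤ 6`: if
  L-λ(q) fails, violators live outside EVERY top-gap class (near-biaxial points).
The constant is existential (it contains the tree's `L⁶` Sobolev constant). NOT CLAIMED: `q > 6`, `q < 2`,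
any value of the best constant, the one-sided node `TopEigHeatCoercivePos q`, Navier–Stokes regularity.
[ours; the no-go seat's Proposition L-λ(η) (pen), now kernel on its whole claimed range]
-/

noncomputable section

open Filter Topology Matrix Finset MeasureTheory
open scoped ContDiff

namespace Summit.NavierStokesRegularity.FunctionalMining

open Literature.Analysis Literature.Analysis.FunctionSpaces Literature.Analysis.FunctionSpaces.Torus
  SharpClass.DirectorForm Literature.Analysis.Matrix

namespace TopEig

variable {v : UnitAddTorus (Fin 3) → EuclideanSpace ℝ (Fin 3)}

/-- **PROPOSITION L-λ(η) AT EXPONENT `2 < q ≤ 6`, KERNEL FORM.** Let `K ≥ 0` satisfy the Sobolev–Hölder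
bound `∫‖v‖²λ₁^{q−2} ≤ KΦ_q(v)` for the field `v` (smooth, divergence free on `T³`), let `0 < η ≤ 1` and
`λ₂ ≤ (1−η)λ₁` pointwise. Then `(ηq/(3(q−1)(K+1))) · Φ_q(v) ≤ T_q(v)`. [ours] -/
theorem topEigMoment_rpow_le_heatDissipation_of_gap (hv : Torus.IsSmooth v) (hdiv : Torus.IsDivFree v)
    {q : ℝ} (hq : 2 < q) {η : ℝ} (hη0 : 0 < η) (hη1 : η ≤ 1)
    (hgap : ∀ x : UnitAddTorus (Fin 3), torusStrainMidEig v x ≤ (1 - η) * torusStrainTopEig v x)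
    {K : ℝ} (hK0 : 0 ≤ K) (hK : ∫ x, ‖v x‖ ^ 2 * torusStrainTopEig v x ^ (q - 2) ≤ K * torusTopEigMoment q v) :
    η * q / (3 * (q - 1) * (K + 1)) * torusTopEigMoment q v ≤ heatDissipation (torusTopEigMoment q) v := by
  have hq1 : (1 : ℝ) ≤ q := by linarith
  have hq0 : 0 < q := by linarith
  set F : ℝ := torusTopEigMoment q v with hFdef
  set T : ℝ := heatDissipation (torusTopEigMoment q) v with hTdef
  set L : ℝ := ∫ x, torusStrainTopEig v x ^ (q - 1) with hLdef
  set C : ℝ := ∫ x, torusStrainTopEig v x ^ (q - 2) * ‖StrainL4.strainFlat (Torus.laplacian v) x‖ with hCdef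
  set A : ℝ := Real.sqrt (3 * ((q - 1) / (2 * η))) with hAdef
  have hF0 : 0 ≤ F := torusTopEigMoment_nonneg q v
  have hT0 : 0 ≤ T :=
    heatDissipation_nonneg_of_admissible hq1 convexOn_lam lipschitzWith_lam
      (fun _ hv hdiv x => lam_strainFlat_nonneg hv hdiv x)
      (fun _ hv hdiv => torusTopEigMoment_eq hv hdiv q) hv hdiv
  have hA0 : 0 ≤ A := Real.sqrt_nonneg _
  -- the estimate with `K + 1`
  have hK' : ∫ x, ‖v x‖ ^ 2 * torusStrainTopEig v x ^ (q - 2) ≤ (K + 1) * torusTopEigMoment q v := by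
    nlinarith
  have hfam : ∀ δ : ℝ, 0 < δ →
      F - 2 * δ * L ≤ A * Real.sqrt ((K + 1) * F) * Real.sqrt (2 / q * T + 4 * δ * C) := fun δ hδ =>
    cut_topEigMoment_rpow_estimate hv hdiv hq hη0 hη1 hgap hK' hδ
  -- limits as `δ → 0⁺`
  have hlim1 : Tendsto (fun δ : ℝ => F - 2 * δ * L) (𝓝[>] 0) (𝓝 F) := by
    have hc : Continuous fun δ : ℝ => F - 2 * δ * L := by continuity
    have h := hc.tendsto 0
    simp only [mul_zero, zero_mul, sub_zero] at h
    exact h.mono_left nhdsWithin_le_nhds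
  have hlim2 : Tendsto (fun δ : ℝ => A * Real.sqrt ((K + 1) * F) * Real.sqrt (2 / q * T + 4 * δ * C))
      (𝓝[>] 0) (𝓝 (A * Real.sqrt ((K + 1) * F) * Real.sqrt (2 / q * T))) := by
    have hc : Continuous fun δ : ℝ => A * Real.sqrt ((K + 1) * F) * Real.sqrt (2 / q * T + 4 * δ * C) :=
      continuous_const.mul ((continuous_const.add ((continuous_const.mul continuous_id).mul continuous_const)).sqrt)
    have h := hc.tendsto 0
    simp only [mul_zero, zero_mul, add_zero] at h
    exact h.mono_left nhdsWithin_le_nhds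
  have hev : ∀ᶠ δ in 𝓝[>] (0 : ℝ),
      F - 2 * δ * L ≤ A * Real.sqrt ((K + 1) * F) * Real.sqrt (2 / q * T + 4 * δ * C) :=
    eventually_nhdsWithin_of_forall fun δ hδ => hfam δ hδ
  have hmain : F ≤ A * Real.sqrt ((K + 1) * F) * Real.sqrt (2 / q * T) :=
    le_of_tendsto_of_tendsto hlim1 hlim2 hev
  -- square: `F ≤ A² (K+1) (2/q) T`
  have hK1 : 0 < K + 1 := by linarith
  have hB : F ≤ A ^ 2 * (K + 1) * (2 / q * T) := by
    have hsF : Real.sqrt ((K + 1) * F) = Real.sqrt (K + 1) * Real.sqrt F := Real.sqrt_mul hK1.le F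
    rw [hsF] at hmain
    set s : ℝ := Real.sqrt F with hs
    set r : ℝ := Real.sqrt (2 / q * T) with hr
    have hs0 : 0 ≤ s := Real.sqrt_nonneg _
    have hr0 : 0 ≤ r := Real.sqrt_nonneg _
    have hk0 : 0 ≤ Real.sqrt (K + 1) := Real.sqrt_nonneg _
    have hFsq : F = s ^ 2 := (Real.sq_sqrt hF0).symm
    have hTsq : 2 / q * T = r ^ 2 := (Real.sq_sqrt (by positivity)).symm
    have hKsq : K + 1 = Real.sqrt (K + 1) ^ 2 := (Real.sq_sqrt hK1.le).symm
    rw [hFsq] at hmain ⊢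
    rw [hTsq, hKsq]
    -- `s² ≤ A √(K+1) s r` ⇒ `s ≤ A √(K+1) r` ⇒ `s² ≤ A² (K+1) r²`
    rcases hs0.eq_or_lt with h0 | hpos
    · rw [← h0, zero_pow two_ne_zero]; positivity
    · have h1 : s * s ≤ s * (A * Real.sqrt (K + 1) * r) := by nlinarith
      have h2 : s ≤ A * Real.sqrt (K + 1) * r := le_of_mul_le_mul_left h1 hpos
      have h3 : 0 ≤ A * Real.sqrt (K + 1) * r := by positivity
      calc s ^ 2 ≤ (A * Real.sqrt (K + 1) * r) ^ 2 := pow_le_pow_left₀ hs0 h2 2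
        _ = A ^ 2 * Real.sqrt (K + 1) ^ 2 * (r ^ 2) := by ring
  -- constants: `A² = 3(q−1)/(2η)`, so `A²(K+1)(2/q) = 3(q−1)(K+1)/(ηq)`
  have hA2 : A ^ 2 = 3 * ((q - 1) / (2 * η)) := Real.sq_sqrt (by positivity)
  rw [hA2] at hB
  have hden : 0 < 3 * (q - 1) * (K + 1) := by nlinarith
  have e : 3 * ((q - 1) / (2 * η)) * (K + 1) * (2 / q * T) = (3 * (q - 1) * (K + 1)) / (η * q) * T := by
    field_simp
  rw [e] at hB
  have hηq : 0 < η * q := mul_pos hη0 hq0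
  have hq1' : q - 1 ≠ 0 := by linarith
  have hK1' : K + 1 ≠ 0 := hK1.ne'
  calc η * q / (3 * (q - 1) * (K + 1)) * F
      ≤ η * q / (3 * (q - 1) * (K + 1)) * ((3 * (q - 1) * (K + 1)) / (η * q) * T) :=
        mul_le_mul_of_nonneg_left hB (by positivity)
    _ = T := by field_simp

/-- **THE NODE `TopEigGapCoercivePos q η` HOLDS for every `2 < q ≤ 6` and `η > 0`** — Proposition L-λ(η)
at exponent `q` on the whole top-gap class, existential rate (through the tree's `L⁶` Sobolev constant).
[ours; the no-go seat's Proposition L-λ(η) (SIEVELD §3.4b (4)), kernel] -/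
theorem topEigGapCoercivePos_of_two_lt {q η : ℝ} (hq : 2 < q) (hq6 : q ≤ 6) (hη0 : 0 < η) :
    TopEigGapCoercivePos (d := Fin 3) q η := by
  -- first `0 < η ≤ 1`, then larger `η` by monotonicity of the class
  suffices h : ∀ η' : ℝ, 0 < η' → η' ≤ 1 → TopEigGapCoercivePos (d := Fin 3) q η' by
    rcases le_or_gt η 1 with h1 | h1
    · exact h η hη0 h1
    · exact (h 1 one_pos le_rfl).of_le_eta h1.le
  intro η' hη0' hη1'
  obtain ⟨K, hK0, hK⟩ := exists_integral_norm_sq_mul_topEig_rpow_le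
  refine ⟨η' * q / (3 * (q - 1) * (K + 1)), by
    have : 0 < 3 * (q - 1) * (K + 1) := by nlinarith
    have : 0 < η' * q := by nlinarith
    positivity, ?_⟩
  intro _ u hu hdiv hmean hcls
  exact topEigMoment_rpow_le_heatDissipation_of_gap hu hdiv hq hη0' hη1' hcls hK0
    (hK u hu hdiv hmean q hq hq6)

/-- **THE NODE `TopEigGapCoercivePos q η` FOR EVERY `2 ≤ q ≤ 6`, `η > 0`** — the whole range of the pen
claim (`q = 2`: `topEigGapCoercivePos_two`; `2 < q ≤ 6`: `topEigGapCoercivePos_of_two_lt`). [ours] -/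
theorem topEigGapCoercivePos_of_two_le {q η : ℝ} (hq : 2 ≤ q) (hq6 : q ≤ 6) (hη0 : 0 < η) :
    TopEigGapCoercivePos (d := Fin 3) q η := by
  rcases hq.eq_or_lt with h2 | h2
  · rw [← h2]; exact topEigGapCoercivePos_two hη0
  · exact topEigGapCoercivePos_of_two_lt h2 hq6 hη0

/-- **THE COROLLARY OF SIEVELD §3.4b, NOW UNCONDITIONAL FOR `2 ≤ q ≤ 6`.** If Lemma L-λ(q)
(`TopEigHeatCoercivePos q`, the one-sided open node) FAILS, then for EVERY gap parameter `η > 0` and every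
small rate the violators live OUTSIDE the class `λ₂ ≤ (1−η)λ₁`: a violating sequence develops near-biaxial
points `λ₂ ≈ λ₁` (the dictionary's `violators_outside_gap_of_not_pos` fed with
`topEigGapCoercivePos_of_two_le`). [ours] -/
theorem violators_outside_every_gap_of_not_pos {q η : ℝ} (hq : 2 ≤ q) (hq6 : q ≤ 6) (hη0 : 0 < η)
    (hfail : ¬ TopEigHeatCoercivePos (d := Fin 3) q) :
    ∃ c₀ : ℝ, 0 < c₀ ∧ ∀ c : ℝ, 0 < c → c ≤ c₀ →
      ∃ v : UnitAddTorus (Fin 3) → EuclideanSpace ℝ (Fin 3), Torus.IsSmooth v ∧ Torus.IsDivFree v ∧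
        Torus.HasZeroMean v ∧ ¬ StrainGapClass η v ∧
        heatDissipation (torusTopEigMoment q) v < c * torusTopEigMoment q v :=
  violators_outside_gap_of_not_pos (topEigGapCoercivePos_of_two_le hq hq6 hη0) hfail

end TopEig

end Summit.NavierStokesRegularity.FunctionalMining

end
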